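import Literature.Geometry.Lorentzian.KerrRicciFlat
import HarnessLib

/-!
# Stub `stub_kerrVacuum` of the line `scri-transfer-third-of-burial`: the sub-extremal Kerr
# metric in ingoing Kerr–Schild Cartesian coordinates is Ricci-flat

For real parameters `M`, `a`, `r₀` with `|a| < M` (`Kerr.IsSubextremal M a`), the Kerr–Schild
metric `Kerr.metric M a r₀ = η + 2H ℓ ⊗ ℓ` (`H = M r³/(r⁴ + a² z²)`, `r = Kerr.radius a` the
implicit Kerr–Schild radius) on the chart domain `Kerr.region a r₀ = {r > max r₀ 0} ⊆ E4` has
vanishing Ricci tensor at every point: the named fact `Kerr.isRicciFlat M a r₀` of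
`KerrSchild.lean` (Kerr 1963; Kerr–Schild 1965, §3; O'Neill 1995, Ch. 2, Thm. 2.6.1). The tree
proves the fact for ALL real `M`, `a`, `r₀` as `Kerr.isRicciFlat_holds` (`KerrRicciFlat.lean`,
via Kerr's ingoing coordinates `(t*, r, cos θ, φ)` in which the components are rational); this
file specialises it to the registered stub (the sub-extremality hypothesis is not used).

## References

* R. P. Kerr, *Gravitational field of a spinning mass as an example of algebraically special
  metrics*, Phys. Rev. Lett. 11 (1963) 237–238.
* R. P. Kerr, A. Schild, *A new class of vacuum solutions of the Einstein field equations*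
  (1965), §3.
* B. O'Neill, *The geometry of Kerr black holes* (1995), Ch. 2, Thm. 2.6.1.
-/

set_option linter.dupNamespace false

noncomputable section

open scoped Manifold ContDiff Topology
open Set Function Topology Literature.Geometry.Lorentzian

namespace Summit.FinalStateConjecture.FinalStateConjecture.Theorems.PhaseMixingCapture.WeakCosmicCensorshipMGHD

/-- **Stub `stub_kerrVacuum`: the sub-extremal Kerr metric is Ricci-flat.** For all real `M`, `a`,
`r₀` with `|a| < M`, the Kerr–Schild metric `Kerr.metric M a r₀ = η + 2H ℓ ⊗ ℓ` on
`Kerr.region a r₀ = {r > max r₀ 0}` satisfies `Ric_x = 0` at every point (the named fact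
`Kerr.isRicciFlat M a r₀`, which binds the Levi-Civita instance of the curvature API): a
specialisation of the tree theorem `Kerr.isRicciFlat_holds` (all parameters; Kerr 1963;
Kerr–Schild 1965, §3; O'Neill 1995, Ch. 2, Thm. 2.6.1). [cite: KerrSchild1965, §3] -/
theorem stub_kerrVacuum :
    ∀ [Kerr.Facts] (M a r₀ : ℝ), Kerr.IsSubextremal M a → Kerr.isRicciFlat M a r₀ :=
  fun M a r₀ _ ↦ Kerr.isRicciFlat_holds M a r₀

end Summit.FinalStateConjecture.FinalStateConjecture.Theorems.PhaseMixingCapture.WeakCosmicCensorshipMGHD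

end
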